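import Literature.NumberTheory.LFunctions.Zhang2022.MainTermFormCauchySchwarz

/-!
# The main-term form with two probes:
`|P(g₁,f₁) + P(g₂,f₂)| ≤ √(𝔅(g₁+g₂)·𝔅(f₁)) + √(𝔅(g₂)·𝔅(f₂−f₁))`

Companion to `MainTermFormCauchySchwarz` (repair cell `pub-zhang`, audit + repair census of
Y. Zhang, *Discrete mean estimates and the Landau–Siegel zero*, arXiv:2211.02515 (2022)
[Zhang2022LandauSiegel]; the cell's verdict on that manuscript is NEGATIVE — the printed inequality
(8.24) fails, `Zhang2022.not_ineq824` — and this file makes no claim about its Theorems 1–2 and no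
claim about Landau–Siegel zeros).

`MainTermFormCauchySchwarz.not_closing_of_isH1` decides, at main order, every design `(𝔤, f)` of the
cell's ALT seat 2 with ONE probe profile `f`: in the manuscript ((2.29)–(2.30)) the second probe `J₂`
is the functional-equation mirror of `J₁`, so that `ZJ̄₂ ≡ J₁` at main order (Proposition 2.6) and
`Ξ₁* = Σ𝔠*(H₁J̄₁ + H̄₂J₂)ω` pairs the glued profile `𝔤 = g₁ + g₂` (`g₁` the `H₁`-side, `g₂` the
reflected `H₂`-side) with the single `f`. ALT-2 gen 5 (`b2b-zhang-alt-2/ALT-2.md` §11) frees the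
second probe: `J₂` any Dirichlet polynomial of the class (other shift, length, smoothing, or `0`),
with mirror profile `f₂` (printed: `f₂ = f₁`). In the cell's dictionary (lead g2 `STRUCTURE.md` §4:
the main term of a sesquilinear mean `Σ𝔠* 𝔥𝔨̄ ω` of two elements of the span is `P(h,k)·𝔞𝔓`, `P`
the polar form of `𝔅` — forced from the quadratic case by polarisation) the six main-order
constants of such a design are `d = |P(g₁,f₁) + P(g₂,f₂)|` ((2.18)/(10.17): `𝔡′+𝔡`),
`q = 𝔅(g₁+g₂)` ((2.32)), `c_J = 𝔅(f₁)` ((2.33)), `c₂ = 𝔅(g₂)` (§9: `Ξ₁₂`; `𝔅` is invariant under the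
reflection) and `δ = 𝔅(f₁−f₂)` ((11.1)), and the §2 skeleton closes iff `√(q·c_J) + √(c₂·δ) < d`
(`Section2ProbeDefect.EndgameData.false_of_closing_probe` / `exists_consistent_probe`).

**Proved here (axioms `propext`, `Classical.choice`, `Quot.sound`), for all `H¹` profiles:**
* `mainTermFormPolar_add_smul_fst/snd`, `mainTermFormPolar_add_left`, `mainTermFormPolar_sub_right`
  — additivity of the polar form in each argument (from the sesquilinearity lemmas of
  `MainTermFormCauchySchwarz`); `IsH1OnUnitInterval.add/sub`.
* `polar_add_polar_eq` — the rearrangement `P(g₁,f₁) + P(g₂,f₂) = P(g₁+g₂, f₁) + P(g₂, f₂−f₁)`,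
  the profile image of `H₁J̄₁ + H̄₂J₂ = (H₁ + ZH̄₂)J̄₁ − (ZJ̄₁ − J₂)H̄₂` (first display before (2.18)).
* **`norm_polar_add_polar_le`** —
  `|P(g₁,f₁) + P(g₂,f₂)| ≤ √(𝔅(g₁+g₂)·𝔅(f₁)) + √(𝔅(g₂)·𝔅(f₂−f₁))`: two Cauchy–Schwarz
  inequalities for the one PSD form; `le_of_probePair_thresholds`, **`not_closing_of_probePair`** —
  thresholds `𝔅(g₁+g₂) ≤ q`, `𝔅(f₁) ≤ c_J`, `𝔅(g₂) ≤ c₂`, `𝔅(f₂−f₁) ≤ δ`, `d ≤ |P(g₁,f₁)+P(g₂,f₂)|`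
  NEVER satisfy `√(q·c_J) + √(c₂·δ) < d`: at main order the second probe is not a lever, for any
  shift, length or smoothing of `J₂` (the cell's theorem T-ALT2.J2).
* `norm_polar_add_polar_le_oneProbe`, `oneProbe_margin_le` — quantitatively
  `|P(g₁,f₁)+P(g₂,f₂)| ≤ |P(g₁+g₂,f₁)| + √(𝔅(g₂)·𝔅(f₂−f₁))`: the two-probe margin
  `√(q·c_J) + √(c₂δ) − d` is never below the one-probe Cauchy–Schwarz margin
  `√(q·c_J) − |P(g₁+g₂,f₁)|` of `MainTermFormCauchySchwarz` — freeing `J₂` adds at least as much to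
  the bound as to `d`.
* `norm_sum_polar_le`, `not_closing_of_pairings` — the same for ANY finite rearrangement of the
  cross mean into pairings `Σₖ P(uₖ,vₖ)` each estimated by Cauchy–Schwarz (a pivot `K ≠ J₁` in the
  display before (2.18), several probes on either side, …): `|Σₖ P(uₖ,vₖ)| ≤ Σₖ √(𝔅(uₖ)·𝔅(vₖ))`.

What is NOT here: the identification of the manuscript's main terms for a non-printed `J₂` with
these polar values (the dictionary; kernel-checked only for the printed family, `Section2AllIota`),
and any second-order statement (margin-zero designs: `Section2SecondOrder`). All declarations are
elementary and tagged `[folklore]`.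
-/

noncomputable section

open MeasureTheory Set intervalIntegral
open scoped Real ComplexConjugate

namespace Literature.NumberTheory.LFunctions.Zhang2022

variable {u u' v v' f f' g₁ g₁' g₂ g₂' f₁ f₁' f₂ f₂' : ℝ → ℂ}

/-! ### Additivity of the polar form -/

/-- `P(u + t f, v) = P(u,v) + t·P(f,v)` on `H¹`. [folklore] -/
theorem mainTermFormPolar_add_smul_fst (hu : IsH1OnUnitInterval u u')
    (hf : IsH1OnUnitInterval f f') (hv : IsH1OnUnitInterval v v') (t : ℂ) :
    mainTermFormPolar (fun x => u x + t * f x) (fun x => u' x + t * f' x) v v'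
      = mainTermFormPolar u u' v v' + t * mainTermFormPolar f f' v v' := by
  simp only [mainTermFormPolar, mainTermFormSesq_add_smul_left hu hf hv t,
    mainTermFormSesq_add_smul_right hv hu hf t, map_add, map_mul, Complex.conj_conj]
  ring

/-- `P(u, v + t f) = P(u,v) + conj t · P(u,f)` on `H¹`. [folklore] -/
theorem mainTermFormPolar_add_smul_snd (hu : IsH1OnUnitInterval u u')
    (hv : IsH1OnUnitInterval v v') (hf : IsH1OnUnitInterval f f') (t : ℂ) :
    mainTermFormPolar u u' (fun x => v x + t * f x) (fun x => v' x + t * f' x)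
      = mainTermFormPolar u u' v v' + conj t * mainTermFormPolar u u' f f' := by
  simp only [mainTermFormPolar, mainTermFormSesq_add_smul_left hv hf hu t,
    mainTermFormSesq_add_smul_right hu hv hf t, map_add, map_mul]
  ring

namespace IsH1OnUnitInterval

/-- `u + v ∈ H¹` with derivative `u′ + v′`. [folklore] -/
theorem add (hu : IsH1OnUnitInterval u u') (hv : IsH1OnUnitInterval v v') :
    IsH1OnUnitInterval (u + v) (u' + v') := by
  have h := hu.add_smul hv 1
  simp only [one_mul] at h
  exact h

/-- `u − v ∈ H¹` with derivative `u′ − v′`. [folklore] -/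
theorem sub (hu : IsH1OnUnitInterval u u') (hv : IsH1OnUnitInterval v v') :
    IsH1OnUnitInterval (u - v) (u' - v') := by
  have h := hu.add_smul hv (-1)
  simp only [neg_one_mul, ← sub_eq_add_neg] at h
  exact h

end IsH1OnUnitInterval

/-- `P(u + f, v) = P(u,v) + P(f,v)` on `H¹`. [folklore] -/
theorem mainTermFormPolar_add_left (hu : IsH1OnUnitInterval u u')
    (hf : IsH1OnUnitInterval f f') (hv : IsH1OnUnitInterval v v') :
    mainTermFormPolar (u + f) (u' + f') v v'
      = mainTermFormPolar u u' v v' + mainTermFormPolar f f' v v' := by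
  have h := mainTermFormPolar_add_smul_fst hu hf hv 1
  simp only [one_mul] at h
  exact h

/-- `P(u, v − f) = P(u,v) − P(u,f)` on `H¹`. [folklore] -/
theorem mainTermFormPolar_sub_right (hu : IsH1OnUnitInterval u u')
    (hv : IsH1OnUnitInterval v v') (hf : IsH1OnUnitInterval f f') :
    mainTermFormPolar u u' (v - f) (v' - f')
      = mainTermFormPolar u u' v v' - mainTermFormPolar u u' f f' := by
  have h := mainTermFormPolar_add_smul_snd hu hv hf (-1)
  simp only [neg_one_mul, ← sub_eq_add_neg, map_neg, map_one] at h
  exact h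

/-! ### Two probes -/

/-- The rearrangement `P(g₁,f₁) + P(g₂,f₂) = P(g₁+g₂, f₁) + P(g₂, f₂ − f₁)` — the profile image of
`H₁J̄₁ + H̄₂J₂ = (H₁ + ZH̄₂)J̄₁ − (ZJ̄₁ − J₂)H̄₂` (first display before (2.18)). [folklore] -/
theorem polar_add_polar_eq (hg₁ : IsH1OnUnitInterval g₁ g₁') (hg₂ : IsH1OnUnitInterval g₂ g₂')
    (hf₁ : IsH1OnUnitInterval f₁ f₁') (hf₂ : IsH1OnUnitInterval f₂ f₂') :
    mainTermFormPolar g₁ g₁' f₁ f₁' + mainTermFormPolar g₂ g₂' f₂ f₂'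
      = mainTermFormPolar (g₁ + g₂) (g₁' + g₂') f₁ f₁'
        + mainTermFormPolar g₂ g₂' (f₂ - f₁) (f₂' - f₁') := by
  rw [mainTermFormPolar_add_left hg₁ hg₂ hf₁, mainTermFormPolar_sub_right hg₂ hf₂ hf₁]
  ring

/-- **Two probes, two Cauchy–Schwarz inequalities for the one PSD form**:
`|P(g₁,f₁) + P(g₂,f₂)| ≤ √(𝔅(g₁+g₂)·𝔅(f₁)) + √(𝔅(g₂)·𝔅(f₂−f₁))` for `H¹` profiles. [folklore] -/
theorem norm_polar_add_polar_le (hg₁ : IsH1OnUnitInterval g₁ g₁')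
    (hg₂ : IsH1OnUnitInterval g₂ g₂') (hf₁ : IsH1OnUnitInterval f₁ f₁')
    (hf₂ : IsH1OnUnitInterval f₂ f₂') :
    ‖mainTermFormPolar g₁ g₁' f₁ f₁' + mainTermFormPolar g₂ g₂' f₂ f₂'‖
      ≤ Real.sqrt (mainTermForm (g₁ + g₂) (g₁' + g₂') * mainTermForm f₁ f₁')
        + Real.sqrt (mainTermForm g₂ g₂' * mainTermForm (f₂ - f₁) (f₂' - f₁')) := by
  rw [polar_add_polar_eq hg₁ hg₂ hf₁ hf₂]
  exact (norm_add_le _ _).trans (add_le_add (norm_mainTermFormPolar_le_sqrt (hg₁.add hg₂) hf₁)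
    (norm_mainTermFormPolar_le_sqrt hg₂ (hf₂.sub hf₁)))

/-- The same with only the defect pairing estimated:
`|P(g₁,f₁) + P(g₂,f₂)| ≤ |P(g₁+g₂, f₁)| + √(𝔅(g₂)·𝔅(f₂−f₁))`. [folklore] -/
theorem norm_polar_add_polar_le_oneProbe (hg₁ : IsH1OnUnitInterval g₁ g₁')
    (hg₂ : IsH1OnUnitInterval g₂ g₂') (hf₁ : IsH1OnUnitInterval f₁ f₁')
    (hf₂ : IsH1OnUnitInterval f₂ f₂') :
    ‖mainTermFormPolar g₁ g₁' f₁ f₁' + mainTermFormPolar g₂ g₂' f₂ f₂'‖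
      ≤ ‖mainTermFormPolar (g₁ + g₂) (g₁' + g₂') f₁ f₁'‖
        + Real.sqrt (mainTermForm g₂ g₂' * mainTermForm (f₂ - f₁) (f₂' - f₁')) := by
  rw [polar_add_polar_eq hg₁ hg₂ hf₁ hf₂]
  exact (norm_add_le _ _).trans
    (add_le_add le_rfl (norm_mainTermFormPolar_le_sqrt hg₂ (hf₂.sub hf₁)))

/-- **Main-order thresholds of a two-probe design never close the final step of §2.** If for `H¹`
profiles `g₁` (`H₁`-side), `g₂` (reflected `H₂`-side), `f₁` (probe `J₁`) and `f₂` (mirror profile of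
the probe `J₂`; printed: `f₂ = f₁`) the main-order constants satisfy `𝔅(g₁+g₂) ≤ q` ((2.32)-type),
`𝔅(f₁) ≤ c_J` ((2.33)-type), `𝔅(g₂) ≤ c₂` (§9-type), `𝔅(f₂−f₁) ≤ δ` ((11.1)-type) and
`d ≤ |P(g₁,f₁) + P(g₂,f₂)|` ((2.18)/Prop. 2.4-type), then `d ≤ √(q·c_J) + √(c₂·δ)`. [folklore] -/
theorem le_of_probePair_thresholds (hg₁ : IsH1OnUnitInterval g₁ g₁')
    (hg₂ : IsH1OnUnitInterval g₂ g₂') (hf₁ : IsH1OnUnitInterval f₁ f₁')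
    (hf₂ : IsH1OnUnitInterval f₂ f₂') {q cJ c₂ δ d : ℝ}
    (hq : mainTermForm (g₁ + g₂) (g₁' + g₂') ≤ q) (hcJ : mainTermForm f₁ f₁' ≤ cJ)
    (hc₂ : mainTermForm g₂ g₂' ≤ c₂) (hδ : mainTermForm (f₂ - f₁) (f₂' - f₁') ≤ δ)
    (hd : d ≤ ‖mainTermFormPolar g₁ g₁' f₁ f₁' + mainTermFormPolar g₂ g₂' f₂ f₂'‖) :
    d ≤ Real.sqrt (q * cJ) + Real.sqrt (c₂ * δ) := by
  have h0g := mainTermForm_nonneg_of_isH1 (hg₁.add hg₂)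
  have h0f := mainTermForm_nonneg_of_isH1 hf₁
  have h02 := mainTermForm_nonneg_of_isH1 hg₂
  have h0d := mainTermForm_nonneg_of_isH1 (hf₂.sub hf₁)
  refine hd.trans ((norm_polar_add_polar_le hg₁ hg₂ hf₁ hf₂).trans (add_le_add ?_ ?_))
  · exact Real.sqrt_le_sqrt (mul_le_mul hq hcJ h0f (h0g.trans hq))
  · exact Real.sqrt_le_sqrt (mul_le_mul hc₂ hδ h0d (h02.trans hc₂))

/-- Hence the closing condition `√(q·c_J) + √(c₂·δ) < d` of
`Section2ProbeDefect.EndgameData.false_of_closing_probe` FAILS for every quadruple of `H¹` profiles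
and every such quintuple of thresholds: at main order the choice of the second probe (its shift in
(2.30), its length, its smoothing, its presence) is not a lever (the cell's theorem T-ALT2.J2).
[folklore] -/
theorem not_closing_of_probePair (hg₁ : IsH1OnUnitInterval g₁ g₁')
    (hg₂ : IsH1OnUnitInterval g₂ g₂') (hf₁ : IsH1OnUnitInterval f₁ f₁')
    (hf₂ : IsH1OnUnitInterval f₂ f₂') {q cJ c₂ δ d : ℝ}
    (hq : mainTermForm (g₁ + g₂) (g₁' + g₂') ≤ q) (hcJ : mainTermForm f₁ f₁' ≤ cJ)
    (hc₂ : mainTermForm g₂ g₂' ≤ c₂) (hδ : mainTermForm (f₂ - f₁) (f₂' - f₁') ≤ δ)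
    (hd : d ≤ ‖mainTermFormPolar g₁ g₁' f₁ f₁' + mainTermFormPolar g₂ g₂' f₂ f₂'‖) :
    ¬ (Real.sqrt (q * cJ) + Real.sqrt (c₂ * δ) < d) :=
  not_lt.2 (le_of_probePair_thresholds hg₁ hg₂ hf₁ hf₂ hq hcJ hc₂ hδ hd)

/-- **The second probe never beats the one-probe margin**: the two-probe margin
`√(𝔅(g₁+g₂)𝔅(f₁)) + √(𝔅(g₂)𝔅(f₂−f₁)) − |P(g₁,f₁)+P(g₂,f₂)|` is at least the one-probe
Cauchy–Schwarz margin `√(𝔅(g₁+g₂)𝔅(f₁)) − |P(g₁+g₂,f₁)|` of `MainTermFormCauchySchwarz` (which is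
`≥ 0`, and `= 0` only on the equality locus of `MainTermFormCSEquality`). [folklore] -/
theorem oneProbe_margin_le (hg₁ : IsH1OnUnitInterval g₁ g₁')
    (hg₂ : IsH1OnUnitInterval g₂ g₂') (hf₁ : IsH1OnUnitInterval f₁ f₁')
    (hf₂ : IsH1OnUnitInterval f₂ f₂') :
    Real.sqrt (mainTermForm (g₁ + g₂) (g₁' + g₂') * mainTermForm f₁ f₁')
        - ‖mainTermFormPolar (g₁ + g₂) (g₁' + g₂') f₁ f₁'‖
      ≤ Real.sqrt (mainTermForm (g₁ + g₂) (g₁' + g₂') * mainTermForm f₁ f₁')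
        + Real.sqrt (mainTermForm g₂ g₂' * mainTermForm (f₂ - f₁) (f₂' - f₁'))
        - ‖mainTermFormPolar g₁ g₁' f₁ f₁' + mainTermFormPolar g₂ g₂' f₂ f₂'‖ := by
  linarith [norm_polar_add_polar_le_oneProbe hg₁ hg₂ hf₁ hf₂]

/-! ### Any finite family of pairings -/

/-- For ANY finite rearrangement of the cross mean into pairings, each estimated by Cauchy–Schwarz
for the one PSD form: `|Σₖ P(uₖ,vₖ)| ≤ Σₖ √(𝔅(uₖ)·𝔅(vₖ))` (`H¹` profiles). The manuscript's (2.18)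
is `k = 2` with pairs `(g₁+g₂, f₁)`, `(g₂, f₂−f₁)`; a pivot `K` other than `J₁` in the display before
(2.18) is `k = 3` with pairs `(g₁+g₂, k)`, `(g₁, f₁−k)`, `(g₂, f₂−k)`. [folklore] -/
theorem norm_sum_polar_le {κ : Type*} (s : Finset κ) {U U' V V' : κ → ℝ → ℂ}
    (hU : ∀ k ∈ s, IsH1OnUnitInterval (U k) (U' k))
    (hV : ∀ k ∈ s, IsH1OnUnitInterval (V k) (V' k)) :
    ‖∑ k ∈ s, mainTermFormPolar (U k) (U' k) (V k) (V' k)‖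
      ≤ ∑ k ∈ s, Real.sqrt (mainTermForm (U k) (U' k) * mainTermForm (V k) (V' k)) :=
  (norm_sum_le _ _).trans
    (Finset.sum_le_sum fun k hk => norm_mainTermFormPolar_le_sqrt (hU k hk) (hV k hk))

/-- Hence thresholds `𝔅(uₖ) ≤ qₖ`, `𝔅(vₖ) ≤ cₖ`, `d ≤ |Σₖ P(uₖ,vₖ)|` of polar provenance never satisfy
the closing condition `Σₖ √(qₖ·cₖ) < d` of such a rearranged skeleton. [folklore] -/
theorem not_closing_of_pairings {κ : Type*} (s : Finset κ) {U U' V V' : κ → ℝ → ℂ}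
    (hU : ∀ k ∈ s, IsH1OnUnitInterval (U k) (U' k))
    (hV : ∀ k ∈ s, IsH1OnUnitInterval (V k) (V' k)) {q c : κ → ℝ} {d : ℝ}
    (hq : ∀ k ∈ s, mainTermForm (U k) (U' k) ≤ q k) (hc : ∀ k ∈ s, mainTermForm (V k) (V' k) ≤ c k)
    (hd : d ≤ ‖∑ k ∈ s, mainTermFormPolar (U k) (U' k) (V k) (V' k)‖) :
    ¬ (∑ k ∈ s, Real.sqrt (q k * c k) < d) := by
  refine not_lt.2 (hd.trans ((norm_sum_polar_le s hU hV).trans (Finset.sum_le_sum fun k hk => ?_)))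
  have h0U := mainTermForm_nonneg_of_isH1 (hU k hk)
  have h0V := mainTermForm_nonneg_of_isH1 (hV k hk)
  exact Real.sqrt_le_sqrt (mul_le_mul (hq k hk) (hc k hk) h0V (h0U.trans (hq k hk)))

end Literature.NumberTheory.LFunctions.Zhang2022
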